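import Summits.SmoothPoincare4.SmoothPoincare4.Theses.EntropyRung
import Summits.SmoothPoincare4.SmoothPoincare4.Theorems.EntropyRungCompactShrinkerGapScalarIdentities
import Summits.SmoothPoincare4.SmoothPoincare4.Theorems.EntropyRungCompactShrinkerGapSigmaTwo
import Literature.Geometry.Riemannian.ChangGurskyYang
import Literature.Geometry.Riemannian.ChangGurskyYangEuler
import Literature.Geometry.Riemannian.ChangGurskyYangRegularity
import Literature.Geometry.Riemannian.ChernGaussBonnetFour
import Literature.Topology.FourManifolds.HomotopyS4SimplyConnected
import Literature.Topology.FourManifolds.SphereSimplyConnected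
import HarnessLib

/-!
# drefute gen 3 — the RESIDUAL of line `cgy-variance-pivot` after the landings (kernel-checked, 0 sorry)

With stubs 2/3/4/7 PROVED in the tree (p71473, p71672, p71988, p71839), STUB 5 vendored as the Literature
fact `chernGaussBonnet_four` (p72262) and STUB 6 promoted to the route crux `EntropyRung.ChangGurskyYang`
(stmt-10834, definitionally `changGurskyYang_sphere_four`), the crux `CompactShrinkerGap` is EXACTLY

  `chernGaussBonnet_four → changGurskyYang_sphere_four → VarianceBudget → CompactShrinkerGap`

where `VarianceBudget` is the statement of `stub_varianceBudget` (STUB 1, the one open stub) copied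
verbatim. This file proves that implication with no `sorry`, i.e. certifies for the lead and the dossier
that nothing but STUB 1 (plus the two classical named debts) stands between the line and the crux.
Evidence only (a conditional positive composition is not a refuter landing).
-/

noncomputable section

open MeasureTheory Set
open scoped Manifold ContDiff ENNReal Topology ContinuousMap MeasureTheory

namespace Summit.SmoothPoincare4.SmoothPoincare4.Cruxes.CompactShrinkerGap.DrefuteG3Residual

open Summit.SmoothPoincare4.SmoothPoincare4.Theses.EntropyRung (CompactShrinkerGap)

/-- STUB 1 of `Lines/cgy-variance-pivot.lean` (sha 343b93d2), verbatim, as a named proposition. -/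
def VarianceBudget : Prop :=
    ∀ (M : Type) [TopologicalSpace M] [T2Space M] [SecondCountableTopology M]
      [ChartedSpace (EuclideanSpace ℝ (Fin 4)) M] [IsManifold (𝓡 4) ∞ M] [CompactSpace M]
      [T3Space M] [MeasurableSpace M] [BorelSpace M],
      M ≃ₕ Metric.sphere (0 : EuclideanSpace ℝ (Fin 5)) 1 →
    ∀ (g : Literature.Geometry.Lorentzian.PseudoRiemannianMetric (𝓡 4) ∞ (EuclideanSpace ℝ (Fin 4))
        (TangentSpace (𝓡 4) : M → Type _)) [g.HasLeviCivita] (f : M → ℝ) (hg : g.IsRiemannian),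
      ContMDiff (𝓡 4) 𝓘(ℝ, ℝ) ∞ f →
      (∀ (x : M) (X Y : TangentSpace (𝓡 4) x),
        g.ricci x X Y + g.hessian f x X Y = (1 / 2 : ℝ) * g.val x X Y) →
      (∀ x : M, g.scalarCurvature x + g.gradSq f x = f x) →
      ENNReal.ofReal (32 * Real.pi ^ 2 * Real.sqrt Real.pi * Real.exp (-(3 : ℝ) / 2)) <
        ∫⁻ x, ENNReal.ofReal (Real.exp (-f x))
          ∂(Literature.Geometry.Lorentzian.riemannianMeasure (g.toContMDiffRiemannianMetric hg)) →
      ∫ x, (g.scalarCurvature x - 2) ^ 2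
          ∂(Literature.Geometry.Lorentzian.riemannianMeasure (g.toContMDiffRiemannianMetric hg)) <
        2 * ((Literature.Geometry.Lorentzian.riemannianMeasure (g.toContMDiffRiemannianMetric hg))
              Set.univ).toReal - 96 * Real.pi ^ 2


/-- STUB 4 verbatim (PROVED in the tree as `Summit.SmoothPoincare4.SmoothPoincare4.Theorems.stub_scalarCurvaturePos_of_identities`,
p71988; taken as a hypothesis here only because the farm snapshot had not yet built that module). -/
def ScalarCurvaturePos : Prop :=
    ∀ (M : Type) [TopologicalSpace M] [T2Space M] [SecondCountableTopology M]
      [ChartedSpace (EuclideanSpace ℝ (Fin 4)) M] [IsManifold (𝓡 4) ∞ M] [CompactSpace M]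
      (g : Literature.Geometry.Lorentzian.PseudoRiemannianMetric (𝓡 4) ∞ (EuclideanSpace ℝ (Fin 4))
        (TangentSpace (𝓡 4) : M → Type _)) [g.HasLeviCivita] (f : M → ℝ), g.IsRiemannian →
      ContMDiff (𝓡 4) 𝓘(ℝ, ℝ) ∞ f →
      (∀ (x : M) (X Y : TangentSpace (𝓡 4) x),
        g.ricci x X Y + g.hessian f x X Y = (1 / 2 : ℝ) * g.val x X Y) →
      (∀ x : M, g.dalembertian g.scalarCurvature x =
        g.innerDual x (mvfderiv (𝓡 4) g.scalarCurvature x : TangentSpace (𝓡 4) x →ₗ[ℝ] ℝ)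
            (mvfderiv (𝓡 4) f x : TangentSpace (𝓡 4) x →ₗ[ℝ] ℝ) +
          g.scalarCurvature x - 2 * g.normSq x (g.ricci x)) →
      ∀ x : M, 0 < g.scalarCurvature x

/-- **The residual implication** (same proof term as the skeleton's `diffeomorph_sphere_of_varianceBudget`
/ `CompactShrinkerGap_of`, with every `stub_*` replaced by the landed theorem or the named hypothesis).
[cite: ChangGurskyYang2003, Thm. A and (1.1)] -/
theorem compactShrinkerGap_of_cgb_cgy_budget (hPos : ScalarCurvaturePos)
    (hCGB4 : Literature.Geometry.Riemannian.chernGaussBonnet_four)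
    (hCGY : Literature.Geometry.Riemannian.changGurskyYang_sphere_four)
    (hB : VarianceBudget) : CompactShrinkerGap := by
  intro M _ _ _ _ _ _ _ _ _ e g _ f hg hf hsol hnorm hdens
  have hbudget := hB M e g f hg hf hsol hnorm hdens
  haveI : SimplyConnectedSpace M :=
    Literature.Topology.FourManifolds.simplyConnectedSpace_of_homotopyEquiv_sphere_four
      Literature.Topology.FourManifolds.simplyConnectedSpace_sphere_four_holds M e
  have hχ : Literature.AlgebraicTopology.SingularHomology.relEuler ℤ ℤ M ∅ = 2 :=
    (Literature.Topology.FourManifolds.finRelHomology_of_homotopyEquiv_sphere_four e).2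
  obtain ⟨_, hBi⟩ :=
    Summit.SmoothPoincare4.SmoothPoincare4.Theorems.stub_shrinkerScalarIdentities M g f hg hf hsol
  have hR : ∀ x : M, 0 < g.scalarCurvature x := hPos M g f hg hf hsol hBi
  have hσ :=
    Summit.SmoothPoincare4.SmoothPoincare4.Theorems.stub_sigmaTwo_of_identities M g f hg hf hsol hBi
  have hCGB := hCGB4 M g hg
  rw [hχ] at hCGB
  push_cast at hCGB
  have hWr : g.weylEnergy.toReal < 32 * Real.pi ^ 2 := by
    linarith [hCGB, hσ, hbudget]
  have hW : g.weylEnergy < ENNReal.ofReal (32 * Real.pi ^ 2) :=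
    (ENNReal.lt_ofReal_iff_toReal_lt (g.weylEnergy_lt_top hg).ne).2 hWr
  exact hCGY M ⟨g, ‹_›, hg, hR, hW⟩

end Summit.SmoothPoincare4.SmoothPoincare4.Cruxes.CompactShrinkerGap.DrefuteG3Residual

end
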